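import Mathlib.Data.Real.Basic
import Mathlib.Tactic.NormNum
import Mathlib.Tactic.Ring
import Mathlib.Tactic.Linarith
import Mathlib.Tactic.Positivity
import HarnessLib

/-!
# `NoHeavyLowerTail` (stmt-CriticalPhenomena-4575) — SHK3⁺ / 3PT-LB: the terminal-edge step in BERNSTEIN form (algebraic core), and its apex no-go

Support file (prover prim-ineq-prove-2 gen 2; `--supports stmt-CriticalPhenomena-4575`).  Pure algebra: no measure theory, no
definitions beyond polynomials, no named facts, no sorries.  Companion of `PercNearOneGluingNoHeavyLowerTailCubicThreePointNoGo`
(prim-gen-kcluster gen 7), same cell convention `(q, u₁, u₂, u₃, t) = (P(a|b|c), P(ab|c), P(ac|b), P(bc|a), P(abc))`.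

WHAT.  SHK3⁺ is the homogeneous cubic `F(x) = (σ + t)(q t − e₂(u)) − e₃(u)`, `σ = q+u₁+u₂+u₃+t` (for a law, `σ = 1`, and `F ≥ 0` is
Richards–Sahi `E₃ ≥ 0` on the three pairwise-separation events = the three-point lower bound
`P(abc)(1+Σ P(xy)) ≥ e₂(P(xy)) + e₃(P(xy))`).  Conditioning on ONE edge `e = {a,m}` at the terminal `a` ("apex edge") writes the law of
`G` with `w_e = λ` as `(1−λ)x⁰ + λx¹`, `x⁰` = law of `G∖e`, `x¹` = law of `G/e`, and the only transitions are
`Q → ab|c` (mass `α₁`: `m ~ b`), `Q → ac|b` (`α₂`), `ab|c → abc` (`β₁`), `ac|b → abc` (`β₂`), `bc|a → abc` (`β₃`)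
(a `b–c` connection gained through `e` passes through `a`).  Along such a segment
      `F(x_λ) = F(x⁰)(1−λ)³ + B₁·(1−λ)²λ + B₂·(1−λ)λ² + F(x¹)λ³`
with the EXPLICIT cubic polynomials `B₁ = threeB₁`, `B₂ = threeB₂` below (three times the Bernstein coefficients / polarisations
`F_h(x⁰,x⁰,x¹)`, `F_h(x⁰,x¹,x¹)`): `bernstein_expansion` (by `ring`).  Hence (`F_segment_nonneg_of_bernstein`) SHK3⁺ for `G` follows from
SHK3⁺ for `G∖e` and `G/e` (induction on the number of edges) PLUS `B₁ ≥ 0`, `B₂ ≥ 0` — the two 4-point inequalities (B1),(B2) of the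
terminal-edge induction (0 violations in ttrl2's exhaustive weighted census `bern4`, 3.1·10⁶ instances n ≤ 7; no certificate over the
Harris/AG/GZ cone, bern4/SDP.md).  The step is NOT pure 5-cell algebra: `apexNoGo_*` records an apex-shaped pair with
`F(x⁰) = F(x¹) = 0`, `B₁ = B₂ = −1/108`, `F(midpoint) = −1/432` (`x⁰` = law of the path `a–b–c` with `w(ab)=1/3, w(bc)=1/2`;
`α₂ = β₁ = 1/6`), which is however NOT realizable: it violates the Harris inequality between the sections `{b~c}⁰` and `{a~c}¹`
(`μ({b~c}⁰ ∩ {a~c}¹) ≥ μ({b~c}⁰)μ({a~c}¹)` reads `t + β₃ ≥ (t+u₃)(t+u₂+α₂+β₁+β₃)`, here `1/6 ≥ 1/4`, false) — `apexNoGo_sectionHarris`.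
Memo: run/shared/lean/prim/prim-ineq-prove-2/MEMO-7-3PTLB-INDUCTION.md.
[cite: Gladkov2024StrongFKG, Cor. 4.2 (quadratic part)]; [cite: GladkovZimin2024HK, §4 (coordinate induction)]
-/

namespace Summit.CriticalPhenomena.PercolationContinuityZ3.Theorems

namespace CubicThreePointStep

variable {R : Type*} [CommRing R]

/-- The homogeneous cubic SHK3⁺ form `F(q,u₁,u₂,u₃,t) = (σ + t)(q t − e₂(u)) − e₃(u)`, `σ = q+u₁+u₂+u₃+t`, over any commutative ring
(same polynomial as `CubicThreePoint.shk3` over `ℚ`). [cite: Gladkov2024StrongFKG, Cor. 4.2 (quadratic part)] -/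
def F (q u₁ u₂ u₃ t : R) : R :=
  (q + u₁ + u₂ + u₃ + t + t) * (q * t - (u₁ * u₂ + u₁ * u₃ + u₂ * u₃)) - u₁ * u₂ * u₃

/-- Three times the first Bernstein coefficient `F_h(x⁰,x⁰,x¹)` of SHK3⁺ along an apex-`a` segment, as an explicit cubic in the cells of
`x⁰ = (q,u₁,u₂,u₃,t)` and the transition masses `α₁ (Q→ab|c), α₂ (Q→ac|b), β₁ (ab|c→abc), β₂ (ac|b→abc), β₃ (bc|a→abc)`. [folklore] -/
def threeB₁ (q u₁ u₂ u₃ t α₁ α₂ β₁ β₂ β₃ : R) : R :=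
  - 2 * t^2 * α₂ - 2 * t^2 * α₁ + 2 * u₃ * t * β₂ + 2 * u₃ * t * β₁ - 3 * u₃ * t * α₂ - 3 * u₃ * t * α₁ + u₃^2 * β₂ + u₃^2 * β₁ - u₃^2 * α₂ - u₃^2 * α₁ + 2 * u₂ * t * β₃ + 2 * u₂ * t * β₁ - u₂ * t * α₂ - 3 * u₂ * t * α₁ + 2 * u₂ * u₃ * β₁ - u₂ * u₃ * α₂ - 3 * u₂ * u₃ * α₁ - 6 * u₂ * u₃ * t - 3 * u₂ * u₃^2 + u₂^2 * β₃ + u₂^2 * β₁ - u₂^2 * α₁ - 3 * u₂^2 * u₃ + 2 * u₁ * t * β₃ + 2 * u₁ * t * β₂ - 3 * u₁ * t * α₂ - u₁ * t * α₁ + 2 * u₁ * u₃ * β₂ - 3 * u₁ * u₃ * α₂ - u₁ * u₃ * α₁ - 6 * u₁ * u₃ * t - 3 * u₁ * u₃^2 + 2 * u₁ * u₂ * β₃ - u₁ * u₂ * α₂ - u₁ * u₂ * α₁ - 6 * u₁ * u₂ * t - 12 * u₁ * u₂ * u₃ - 3 * u₁ * u₂^2 + u₁^2 * β₃ + u₁^2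 * β₂ - u₁^2 * α₂ - 3 * u₁^2 * u₃ - 3 * u₁^2 * u₂ + 3 * q * t * β₃ + 3 * q * t * β₂ + 3 * q * t * β₁ - q * t * α₂ - q * t * α₁ + 6 * q * t^2 + q * u₃ * β₃ + 2 * q * u₃ * β₂ + 2 * q * u₃ * β₁ - q * u₃ * α₂ - q * u₃ * α₁ + 3 * q * u₃ * t + 2 * q * u₂ * β₃ + q * u₂ * β₂ + 2 * q * u₂ * β₁ - q * u₂ * α₁ + 3 * q * u₂ * t - 3 * q * u₂ * u₃ + 2 * q * u₁ * β₃ + 2 * q * u₁ * β₂ + q * u₁ * β₁ - q * u₁ * α₂ + 3 * q * u₁ * t - 3 * q * u₁ * u₃ - 3 * q * u₁ * u₂ + q^2 * β₃ + q^2 * β₂ + q^2 * β₁ + 3 * q^2 * t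

/-- Three times the second Bernstein coefficient `F_h(x⁰,x¹,x¹)` of SHK3⁺ along an apex-`a` segment (explicit cubic). [folklore] -/
def threeB₂ (q u₁ u₂ u₃ t α₁ α₂ β₁ β₂ β₃ : R) : R :=
  - 2 * t * β₂ * β₃ - 2 * t * β₁ * β₃ - 2 * t * β₁ * β₂ - t * α₂ * β₃ - 3 * t * α₂ * β₂ - t * α₂ * β₁ - t * α₁ * β₃ - t * α₁ * β₂ - 3 * t * α₁ * β₁ - 2 * t * α₁ * α₂ - 4 * t^2 * α₂ - 4 * t^2 * α₁ + u₃ * β₂^2 + u₃ * β₁^2 - u₃ * α₂ * β₃ - 2 * u₃ * α₂ * β₂ - u₃ * α₁ * β₃ - 2 * u₃ * α₁ * β₁ - 2 * u₃ * α₁ * α₂ + 4 * u₃ * t * β₂ + 4 * u₃ * t * β₁ - 6 * u₃ * t * α₂ - 6 * u₃ * t * α₁ + 2 * u₃^2 * β₂ + 2 * u₃^2 * β₁ - 2 * u₃^2 * α₂ - 2 * u₃^2 * α₁ + u₂ * β₃^2 + u₂ * β₁^2 - u₂ * α₂ * β₂ - u₂ * α₁ * β₂ - 2 * u₂ * α₁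 * β₁ - u₂ * α₁ * α₂ + 4 * u₂ * t * β₃ + 4 * u₂ * t * β₁ - 2 * u₂ * t * α₂ - 6 * u₂ * t * α₁ + 4 * u₂ * u₃ * β₁ - 2 * u₂ * u₃ * α₂ - 6 * u₂ * u₃ * α₁ - 6 * u₂ * u₃ * t - 3 * u₂ * u₃^2 + 2 * u₂^2 * β₃ + 2 * u₂^2 * β₁ - 2 * u₂^2 * α₁ - 3 * u₂^2 * u₃ + u₁ * β₃^2 + u₁ * β₂^2 - 2 * u₁ * α₂ * β₂ - u₁ * α₂ * β₁ - u₁ * α₁ * β₁ - u₁ * α₁ * α₂ + 4 * u₁ * t * β₃ + 4 * u₁ * t * β₂ - 6 * u₁ * t * α₂ - 2 * u₁ * t * α₁ + 4 * u₁ * u₃ * β₂ - 6 * u₁ * u₃ * α₂ - 2 * u₁ * u₃ * α₁ - 6 * u₁ * u₃ * t - 3 * u₁ * u₃^2 + 4 * u₁ * u₂ * β₃ - 2 * u₁ * u₂ * α₂ - 2 * u₁ * u₂ * α₁ - 6 * u₁ * u₂ * t - 12 * u₁ * u₂ * u₃ - 3 * u₁ * u₂^2 + 2 * u₁^2 * β₃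 + 2 * u₁^2 * β₂ - 2 * u₁^2 * α₂ - 3 * u₁^2 * u₃ - 3 * u₁^2 * u₂ + q * β₃^2 + q * β₂ * β₃ + q * β₂^2 + q * β₁ * β₃ + q * β₁ * β₂ + q * β₁^2 - q * α₂ * β₂ - q * α₁ * β₁ - q * α₁ * α₂ + 6 * q * t * β₃ + 6 * q * t * β₂ + 6 * q * t * β₁ - 2 * q * t * α₂ - 2 * q * t * α₁ + 6 * q * t^2 + 2 * q * u₃ * β₃ + 4 * q * u₃ * β₂ + 4 * q * u₃ * β₁ - 2 * q * u₃ * α₂ - 2 * q * u₃ * α₁ + 3 * q * u₃ * t + 4 * q * u₂ * β₃ + 2 * q * u₂ * β₂ + 4 * q * u₂ * β₁ - 2 * q * u₂ * α₁ + 3 * q * u₂ * t - 3 * q * u₂ * u₃ + 4 * q * u₁ * β₃ + 4 * q * u₁ * β₂ + 2 * q * u₁ * β₁ - 2 * q * u₁ * α₂ + 3 * q * u₁ * t - 3 * q * u₁ * u₃ - 3 * q * u₁ * u₂ + 2 * q^2 * β₃ + 2 * q^2 * β₂ + 2 * q^2 * β₁ + 3 * q^2 * t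

/-- **Bernstein expansion of SHK3⁺ along an apex edge.**  With `x¹ = (q−α₁−α₂, u₁+α₁−β₁, u₂+α₂−β₂, u₃−β₃, t+β₁+β₂+β₃)` and
`x_l = (1−l)x⁰ + l x¹`:  `F(x_l) = F(x⁰)(1−l)³ + threeB₁·(1−l)²l + threeB₂·(1−l)l² + F(x¹)l³` (polynomial identity). [folklore] -/
theorem bernstein_expansion (q u₁ u₂ u₃ t α₁ α₂ β₁ β₂ β₃ l : R) :
    F (q + l * (-α₁ - α₂)) (u₁ + l * (α₁ - β₁)) (u₂ + l * (α₂ - β₂)) (u₃ + l * (-β₃)) (t + l * (β₁ + β₂ + β₃)) =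
      F q u₁ u₂ u₃ t * (1 - l) ^ 3 + threeB₁ q u₁ u₂ u₃ t α₁ α₂ β₁ β₂ β₃ * ((1 - l) ^ 2 * l) +
        threeB₂ q u₁ u₂ u₃ t α₁ α₂ β₁ β₂ β₃ * ((1 - l) * l ^ 2) +
        F (q - α₁ - α₂) (u₁ + α₁ - β₁) (u₂ + α₂ - β₂) (u₃ - β₃) (t + β₁ + β₂ + β₃) * l ^ 3 := by
  simp only [F, threeB₁, threeB₂]
  ring

/-- A cubic in Bernstein form with nonnegative coefficients is nonnegative on `[0,1]`. [folklore] -/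
theorem bernstein_cubic_nonneg {b₀ b₁ b₂ b₃ l : ℝ} (h₀ : 0 ≤ b₀) (h₁ : 0 ≤ b₁) (h₂ : 0 ≤ b₂) (h₃ : 0 ≤ b₃)
    (hl₀ : 0 ≤ l) (hl₁ : l ≤ 1) :
    0 ≤ b₀ * (1 - l) ^ 3 + b₁ * ((1 - l) ^ 2 * l) + b₂ * ((1 - l) * l ^ 2) + b₃ * l ^ 3 := by
  have hm : 0 ≤ 1 - l := by linarith
  have e₀ : 0 ≤ b₀ * (1 - l) ^ 3 := mul_nonneg h₀ (pow_nonneg hm 3)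
  have e₁ : 0 ≤ b₁ * ((1 - l) ^ 2 * l) := mul_nonneg h₁ (mul_nonneg (pow_nonneg hm 2) hl₀)
  have e₂ : 0 ≤ b₂ * ((1 - l) * l ^ 2) := mul_nonneg h₂ (mul_nonneg hm (pow_nonneg hl₀ 2))
  have e₃ : 0 ≤ b₃ * l ^ 3 := mul_nonneg h₃ (pow_nonneg hl₀ 3)
  linarith

/-- **The terminal-edge step.**  If SHK3⁺ holds at both endpoint laws (`G∖e`, `G/e`) and the two Bernstein coefficients are
nonnegative, then SHK3⁺ holds for every value `l ∈ [0,1]` of the apex edge weight. [folklore] -/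
theorem F_segment_nonneg_of_bernstein {q u₁ u₂ u₃ t α₁ α₂ β₁ β₂ β₃ l : ℝ}
    (h₀ : 0 ≤ F q u₁ u₂ u₃ t) (h₃ : 0 ≤ F (q - α₁ - α₂) (u₁ + α₁ - β₁) (u₂ + α₂ - β₂) (u₃ - β₃) (t + β₁ + β₂ + β₃))
    (h₁ : 0 ≤ threeB₁ q u₁ u₂ u₃ t α₁ α₂ β₁ β₂ β₃) (h₂ : 0 ≤ threeB₂ q u₁ u₂ u₃ t α₁ α₂ β₁ β₂ β₃)
    (hl₀ : 0 ≤ l) (hl₁ : l ≤ 1) :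
    0 ≤ F (q + l * (-α₁ - α₂)) (u₁ + l * (α₁ - β₁)) (u₂ + l * (α₂ - β₂)) (u₃ + l * (-β₃)) (t + l * (β₁ + β₂ + β₃)) := by
  rw [bernstein_expansion]
  exact bernstein_cubic_nonneg h₀ h₁ h₂ h₃ hl₀ hl₁

/-! ### The apex-shaped no-go pair: the step is not pure five-cell algebra -/

/-- `x⁰ = (1/3, 1/6, 0, 1/3, 1/6)` = law of the path `a–b–c` (`w(ab) = 1/3`, `w(bc) = 1/2`; `u₂ = P(ac|b) = 0`): `F(x⁰) = 0`. [folklore] -/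
theorem apexNoGo_F0 : F (1/3 : ℚ) (1/6) 0 (1/3) (1/6) = 0 := by norm_num [F]

/-- The endpoint `x¹ = (1/6, 0, 1/6, 1/3, 1/3)` (apex-`a` transitions `α₂ = 1/6`, `β₁ = 1/6`, all others `0`; it is the law of the path
`b–c–a` with `τ_bc = 2/3, τ_ca = 1/2`): `F(x¹) = 0`. [folklore] -/
theorem apexNoGo_F1 : F ((1/3 : ℚ) - 0 - 1/6) (1/6 + 0 - 1/6) (0 + 1/6 - 0) (1/3 - 0) (1/6 + 1/6 + 0 + 0) = 0 := by
  norm_num [F]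

/-- … yet both Bernstein coefficients are NEGATIVE there: `threeB₁ = threeB₂ = −1/108` … [folklore] -/
theorem apexNoGo_B : threeB₁ (1/3 : ℚ) (1/6) 0 (1/3) (1/6) 0 (1/6) (1/6) 0 0 = -1/108 ∧
    threeB₂ (1/3 : ℚ) (1/6) 0 (1/3) (1/6) 0 (1/6) (1/6) 0 0 = -1/108 := by
  constructor <;> norm_num [threeB₁, threeB₂]

/-- … and SHK3⁺ fails at the midpoint of the segment: `F(x_{1/2}) = −1/432`.  So "F ≥ 0 at both apex-segment endpoints ⇒ F ≥ 0 on
the segment" is FALSE as a statement about five-cell vectors. [folklore] -/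
theorem apexNoGo_mid :
    F ((1/3 : ℚ) + (1/2) * (-0 - 1/6)) (1/6 + (1/2) * (0 - 1/6)) (0 + (1/2) * (1/6 - 0)) (1/3 + (1/2) * (-0))
      (1/6 + (1/2) * (1/6 + 0 + 0)) = -1/432 := by
  norm_num [F]

/-- The pair is NOT realizable by a graph: the Harris inequality between the sections `{b~c}⁰` (b~c without `e`) and `{a~c}¹`
(a~c with `e` open), both increasing events, reads `t + β₃ ≥ (t + u₃)(t + u₂ + α₂ + β₁ + β₃)` in these coordinates; at the no-go
pair the left side is `1/6` and the right side `1/4`. [folklore] -/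
theorem apexNoGo_sectionHarris :
    ((1/6 : ℚ) + 0) < (1/6 + 1/3) * (1/6 + 0 + 1/6 + 1/6 + 0) := by norm_num

end CubicThreePointStep

end Summit.CriticalPhenomena.PercolationContinuityZ3.Theorems
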